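import Summits.BirchSwinnertonDyer.BirchSwinnertonDyer.Theorems.InertBadSignedBranchesInertBadAtThreeHeartTiedFrame
import Summits.BirchSwinnertonDyer.BirchSwinnertonDyer.Theorems.BiquadraticEisensteinDescentEisensteinHeartFlatCMInertBadKPrimeDeuringTransport
import Summits.BirchSwinnertonDyer.BirchSwinnertonDyer.Theorems.BiquadraticEisensteinDescentEisensteinHeartFlatCMInertBadKPrimeKatzFrameBookkeeping
import Summits.BirchSwinnertonDyer.BirchSwinnertonDyer.Theorems.BiquadraticEisensteinDescentEisensteinHeartFlatCMInertBadKPrimeBranchUnramified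
import HarnessLib

set_option linter.dupNamespace false -- `Summit.BirchSwinnertonDyer.BirchSwinnertonDyer.Theorems.…` (summit = sub)
set_option autoImplicit false

/-!
# Crux `InertBadAtThree` (stmt-BirchSwinnertonDyer-19225), line `rubin_e1_inert_three` v7 — registered stub `stub_tiedKatzFrameAtThree`
# (V2@3: «a TIED Katz line frame exists at the route's datum, p = 3») — the CONDITIONAL CLOSER from the two named print facts,
# the `p = 3` twin of BED's `…StubV2AllJ.stub_V2_of_katz_of_deuring` (p625968)

Lead-prover seat `bsd-line-ibd-p1` g8 (cell `pub/bsd-wall`, LINE mode on crux 19225; skeleton v7 sha16 f6b89b5b26dffca7). The registered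
stub `stub_tiedKatzFrameAtThree` is BED's `stub_V2` (crux stmt-21341, line `hsieh_lambda` v3) with `5 ≤ p` replaced by `p = 3`. BED's
conditional closer p625968 (`W` the carrier throughout; Deuring's character for `W` on `ℚ⟮x⟯` by `…DeuringTransport.exists_deuringCharacter_of_hasCM`
via the `ℚ`-isogenous maximal-order model `W₁`; bad-prime ramification `…BranchBadPrimes`; `…KatzFrameBookkeeping` on `W₁`; the tied frame
`…TiedFrame.exists_tiedFrame_of_frame`) uses `5 ≤ p` ONLY as `p ≠ 2` / `2 < p`; THIS FILE is the same assembly at `p = 3`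
(`stub_tiedKatzFrameAtThree_of_katz_of_deuring`: the registered signature VERBATIM after the two named-fact hypotheses), through this seat's
`…InertBadAtThreeHeartTiedFrame.exists_tiedFrame_of_frame_of_ne_two` (p636952). So V2@3 has exactly the status of BED's V2: CLOSED modulo
`hsieh2014mu_prop49_exists_isMeasure` (Katz 1978 / Hida–Tilouine 1993 / Hsieh 2014 Prop. 4.9 — printed for `p` odd unramified in `L`) and
`Deuring_exists_heckeCharacter_of_maximalCM`; the line's residual at `p = 3` is `stub_katzLineDivisibilityAtThree` (V4K@3) alone, plus print.

THEOREMS ONLY (no definition, no named fact, no `sorry`); CONDITIONAL on the two named facts (hypotheses in front; hence a HELPER, no stub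
credit); nothing about V4K@3 or any case of BSD is asserted. Supports, does not close, stmt-BirchSwinnertonDyer-19225. BSD is not proved by
any of this.

References: [Hsieh2014mu] Prop. 4.9 (§4.8), §3.1, §4.1; [Katz1978] (5.3.0); [HidaTilouine1993] Thm. II; [SilvermanATAEC1994] Ch. II
Thm. 9.2, 10.5 (b), Ex. 2.30–2.32; [Washington1997] §13.1–13.2.
-/

noncomputable section

open scoped Classical NumberField IntermediateField
open NumberField IsDedekindDomain Module CongruenceSubgroup WeierstrassCurve IntermediateField Field PowerSeries
open Literature.NumberTheory.EllipticCurves Literature.NumberTheory.GaloisRepresentations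
open Literature.NumberTheory.EllipticCurves.ModularForms Literature.NumberTheory.EllipticCurves.Rank1Residual

namespace Summit.BirchSwinnertonDyer.BirchSwinnertonDyer.Theorems.InertBadSignedBranchesInertBadAtThreeHeartStubV2

open Summit.BirchSwinnertonDyer.BirchSwinnertonDyer.Theorems.InertBadSignedBranchesInertBadAtThreeHeartTiedFrame
  (exists_tiedFrame_of_frame_of_ne_two)
open Summit.BirchSwinnertonDyer.BirchSwinnertonDyer.Theorems.BiquadraticEisensteinDescentEisensteinHeartFlatCMInertBadKPrimeDeuringTransport
  (exists_deuringCharacter_of_hasCM exists_theta_datum_of_hasCM)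
open Summit.BirchSwinnertonDyer.BirchSwinnertonDyer.Theorems.BiquadraticEisensteinDescentEisensteinHeartFlatCMInertBadKPrimeKatzFrameBookkeeping
  (exists_finset_S hS_of_mem hlam_of_mem hramS_of_mem exists_prime_mem_of_mem_D)
open Summit.BirchSwinnertonDyer.BirchSwinnertonDyer.Theorems.BiquadraticEisensteinDescentEisensteinHeartFlatCMInertBadKPrimeBranchUnramified
  (hunr_of_frame)
open Summit.BirchSwinnertonDyer.BirchSwinnertonDyer.Theorems.BiquadraticEisensteinDescentEisensteinHeartFlatCMInertBadKPrimeBranchBadPrimes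
  (not_isUnramifiedAt_compRelNorm_of_bad)
open Summit.BirchSwinnertonDyer.BirchSwinnertonDyer.Theorems.BiquadraticEisensteinDescentEisensteinHeartFlatCMInertBadKPrimeFrameCMSubfield
  (not_mem_range_rat finrank_adjoin_eq_two gen_sq isGalois_adjoin_top isGalois_adjoin exists_ne_one restrictNormal_ne_one)
open Summit.BirchSwinnertonDyer.BirchSwinnertonDyer.Theorems.BiquadraticEisensteinDescentEisensteinHeartFlatCMInertBadKPrimeBiquadraticPrimes
  (not_isSquare_of_cmInert not_exists_sq_eq_of_split sqrt_not_mem_range)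
open Summit.BirchSwinnertonDyer.BirchSwinnertonDyer.Theorems.BiquadraticEisensteinDescentEisensteinHeartFlatCMInertBadKPrimeBiquadraticExists
  (exists_quadratic_sqrt isGalois_of_finrank_eq_two)
open Summit.BirchSwinnertonDyer.BirchSwinnertonDyer.Theorems.BiquadraticEisensteinDescentEisensteinHeartFlatCMInertBadKPrimeThetaRoute
  (not_dvd_discr_of_heegner)

/-- **Stub `stub_tiedKatzFrameAtThree` (V2@3) of line `rubin_e1_inert_three` v7, GIVEN the Katz–Hida–Tilouine existence fact and Deuring's
theorem** — registered signature VERBATIM after the two named-fact hypotheses; the assembly of BED's p625968 at `p = 3`: `L = K′(√d_CM)`,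
`Σ_p = {𝔓′}` (`𝔓′ ∣ 𝔭′`), `S` = primes of `L` above the bad `ℓ ≠ 3`, `T` a half of the conjugate pairs of `S`, `λ = ψ_W ∘ N_{L/K_CM} · ‖·‖_L`,
Hsieh's `ϑ`, Katz periods and line series `G` (`KatzCM.IsBaseChangeLine`), `w₁ ≠ w₂`, `c_L = c_L′ = 1`, with (T), (C), (L), (R) and the
non-vanishing. [cite: Hsieh2014mu, Prop. 4.9 (§4.8)] [cite: Katz1978, (5.3.0)] [cite: HidaTilouine1993, Thm. II]
[cite: SilvermanATAEC1994, Ch. II Thm. 9.2 and Thm. 10.5 (b)] -/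
theorem stub_tiedKatzFrameAtThree_of_katz_of_deuring (hKatz : hsieh2014mu_prop49_exists_isMeasure)
    (hD : Deuring_exists_heckeCharacter_of_maximalCM) :
    ∀ (W : WeierstrassCurve ℚ) [W.IsElliptic] [W.IsGloballyMinimal] (p : ℕ) [Fact p.Prime]
      [NeZero (W.conductorNorm ℤ)] (K : Type) [Field K] [NumberField K],
      W.HasCM → p = 3 → CMInert W p → ¬ Good W p →
      IsImaginaryQuadratic K → SatisfiesHeegnerHypothesis (W.conductorNorm ℤ) K →
      4 < (NumberField.discr K).natAbs → ¬ p ∣ NumberField.classNumber K →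
      ∀ (κ : ZpExtension K p), κ.IsAnticyclotomic →
        ∀ (γ : Field.absoluteGaloisGroup K) [Fact (κ.IsTopGenerator γ)]
          (𝔭 : HeightOneSpectrum (𝓞 K)), ((p : ℕ) : 𝓞 K) ∈ 𝔭.asIdeal →
          𝔭.asIdeal.ramificationIdx (𝓞 ℚ) = 1 → 𝔭.asIdeal.inertiaDeg (𝓞 ℚ) = 1 →
          ∀ (f : CuspForm (CongruenceSubgroup.Gamma0 (W.conductorNorm ℤ)) 2), IsNewformOf W f →
            ∀ (ι' : PadicAlgCl p ≃+* ℂ),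
              (∀ (w : InfinitePlace K) (k : 𝓞 K), k ∈ 𝔭.asIdeal ↔ ‖ι'.symm (w.embedding (k : K))‖ < 1) →
                  ∀ (𝔭' : HeightOneSpectrum (𝓞 K)), ((p : ℕ) : 𝓞 K) ∈ 𝔭'.asIdeal → 𝔭' ≠ 𝔭 →
                  ∃ (L : Type) (_ : Field L) (_ : NumberField L) (_ : Algebra K L) (_ : IsGalois K L)
                    (Sp S T : Finset (HeightOneSpectrum (𝓞 L))) (lam : HeckeCharacter L) (ϑ : L) (CK : ℂ)
                    (Ω : InfinitePlace L → ℂ) (ΩpK : InfinitePlace L → ℂ_[p]) (G : PowerSeries 𝓞_ℂ_[p])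
                    (w₁ w₂ : InfinitePlace L) (cL cL' : ℂ),
                    w₁ ≠ w₂ ∧ (∀ w : InfinitePlace L, w = w₁ ∨ w = w₂) ∧
                    (∀ (χ : HeckeCharacter K) (n : ℕ), 0 < n → (∀ v : HeightOneSpectrum (𝓞 K), χ.IsUnramifiedAt v) →
                      χ.HasInfinityType (fun _ ↦ (n : ℤ)) (fun _ ↦ -(n : ℤ)) →
                      KatzCM.HasKatzType ι' Sp (lam * χ.compRelNorm L) 1 (fun w ↦ if w = w₁ then n else n - 1)) ∧
                    (∀ (χ : HeckeCharacter K) (n : ℕ), 0 < n → (∀ v : HeightOneSpectrum (𝓞 K), χ.IsUnramifiedAt v) →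
                      χ.HasInfinityType (fun _ ↦ (n : ℤ)) (fun _ ↦ -(n : ℤ)) →
                      LFunction.HasEntireContinuation (heckeLFunction (lam * χ.compRelNorm L))) ∧
                    cL ≠ 0 ∧ cL' ≠ 0 ∧
                    (∀ (χ : HeckeCharacter K) (n : ℕ), 0 < n → (∀ v : HeightOneSpectrum (𝓞 K), χ.IsUnramifiedAt v) →
                      χ.HasInfinityType (fun _ ↦ (n : ℤ)) (fun _ ↦ -(n : ℤ)) →
                      ∀ hL : LFunction.HasEntireContinuation (heckeLFunction (lam * χ.compRelNorm L)),
                        hL.continuation 0 = cL * cL' ^ n * rankinSelbergValueHecke f χ 1) ∧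
                    (∀ w ∈ S ∪ KatzCM.primesOver L p, ¬ lam.IsUnramifiedAt w) ∧
                    (∀ w ∈ Sp ∪ T, ¬ lam.IsUnramifiedAt w) ∧
                    CK ≠ 0 ∧ (∀ w, Ω w ≠ 0) ∧ (∀ w, (KatzCM.embeddingAt ι' Sp w ϑ).im ≠ 0) ∧ (∀ w, ΩpK w ≠ 0) ∧
                    KatzCM.IsBaseChangeLine ι' Sp S T κ γ lam ϑ CK Ω ΩpK G := by
  intro W _ _ p _ _ K _ _ hCM hp3 hin hbad hK hHN _hd4 _hh κ _hκ γ _ 𝔭 h𝔭 _he _hf1 f hf ι' hι 𝔭' h𝔭' hne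
  have hp : p.Prime := Fact.out
  have hp2 : p ≠ 2 := by omega
  have hγ : κ.IsTopGenerator γ := Fact.out
  have hne' : 𝔭 ≠ 𝔭' := fun h ↦ hne h.symm
  have hd : ¬ IsSquare ((cmFieldDiscrOfJ W.j : ℤ) : ZMod p) := not_isSquare_of_cmInert hp2 hin
  have hdK : ¬ ∃ y : K, y ^ 2 = (cmFieldDiscrOfJ W.j : K) := not_exists_sq_eq_of_split hK.1 hd h𝔭 h𝔭' hne'
  -- the field `L = K′(√d_CM)` and the CM field `ℚ⟮x⟯ ⊆ L`
  obtain ⟨L, _, _, _, h2, x, hx⟩ := exists_quadratic_sqrt K (cmFieldDiscrOfJ W.j) hdK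
  haveI : IsGalois K L := isGalois_of_finrank_eq_two h2
  have hxK : x ∉ Set.range (algebraMap K L) := sqrt_not_mem_range hdK hx
  have hxQ : x ∉ Set.range (algebraMap ℚ L) := not_mem_range_rat hxK
  haveI : IsGalois ℚ⟮x⟯ L := isGalois_adjoin_top hK h2 hx hxQ
  haveI : IsGalois ℚ ℚ⟮x⟯ := isGalois_adjoin hx hxQ
  have h2K₁ : finrank ℚ ℚ⟮x⟯ = 2 := finrank_adjoin_eq_two hx hxQ
  have hθ : ∃ θ : ℚ⟮x⟯, θ ^ 2 = (cmFieldDiscrOfJ W.j : ℚ⟮x⟯) := ⟨AdjoinSimple.gen ℚ x, gen_sq hx⟩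
  -- the conjugation `c` of `ℚ⟮x⟯`
  obtain ⟨τ, hτ⟩ := exists_ne_one (K := K) (L := L) h2
  have hc : (τ.restrictScalars ℚ).restrictNormal ℚ⟮x⟯ ≠ 1 := restrictNormal_ne_one h2 hx hxK τ hτ
  -- Deuring's character for `W` itself (all thirteen CM `j`, via the isogenous maximal-order model `W₁`)
  obtain ⟨W₁, _, _, hiso, hj₁, _, hK₁, ψ, hψ1, -, -, hψ3₁, hψ4, -⟩ :=
    exists_deuringCharacter_of_hasCM hD W hCM h2K₁ hθ _ hc
  -- the bad primes of `W`, `W₁` are prime to `d_{K′}` (Heegner), `L/ℚ⟮x⟯` is unramified above them, `ψ ∘ N` is ramified there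
  obtain ⟨-, -, δ, -, hδ⟩ := Literature.NumberTheory.QuadraticFields.Quadratic.exists_sq_eq_discr (K := K) hK.1
  have hbadK₁ : ∀ (ℓ : ℕ) [Fact ℓ.Prime], ¬ W₁.HasGoodReductionAtPrime ℓ → ¬ (ℓ : ℤ) ∣ NumberField.discr K := by
    intro ℓ hℓ hℓbad
    refine not_dvd_discr_of_heegner hK hHN hℓ.out ((W.dvd_conductorNorm_iff_not_hasGoodReductionAtPrime ℓ).mpr ?_)
    exact fun hg ↦ hℓbad ((hiso.hasGoodReductionAtPrime_iff ℓ).mp hg)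
  have hunr₁ := hunr_of_frame hK h2 hx hxK hδ W₁ hbadK₁
  have hψbad : ∀ (ℓ : ℕ) [Fact ℓ.Prime], ¬ W.HasGoodReductionAtPrime ℓ →
      ∀ w : HeightOneSpectrum (𝓞 L), (ℓ : 𝓞 L) ∈ w.asIdeal → ¬ (ψ.compRelNorm L).IsUnramifiedAt w := by
    intro ℓ hℓ hℓbad w hw
    exact not_isUnramifiedAt_compRelNorm_of_bad W₁ hj₁ hK₁ hψ3₁ hunr₁ ℓ
      (fun hg ↦ hℓbad ((hiso.hasGoodReductionAtPrime_iff ℓ).mpr hg)) w hw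
  -- the CM-field element
  obtain ⟨θ₀, a, hcθ, hθ', hθram⟩ := exists_theta_datum_of_hasCM W hCM h2K₁ hθ hc
  -- the set `S` of primes of `L` above the bad `ℓ ≠ p` and its bookkeeping (on `W₁`)
  obtain ⟨S, hSmem⟩ := exists_finset_S (L := L) W₁ p
  have hbad₁ : ¬ W₁.HasGoodReductionAtPrime p := fun hg ↦ hbad ((hiso.hasGoodReductionAtPrime_iff p).mpr hg)
  have hS : ∀ w ∈ S, ((p : ℕ) : 𝓞 L) ∉ w.asIdeal := hS_of_mem W₁ p hSmem
  have hlam : ∀ w : HeightOneSpectrum (𝓞 L), w ∉ S → ((p : ℕ) : 𝓞 L) ∉ w.asIdeal →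
      (ψ.compRelNorm L * HeckeCharacter.normCharacter L).IsUnramifiedAt w := hlam_of_mem p hSmem hj₁ hK₁ hψ3₁
  have hramS : ∀ w ∈ S ∪ KatzCM.primesOver L p,
      ¬ (ψ.compRelNorm L * HeckeCharacter.normCharacter L).IsUnramifiedAt w :=
    hramS_of_mem p hSmem hj₁ hK₁ hψ3₁ hbad₁ hunr₁
  have hSP : ∀ w ∈ S, ∃ ℓ ∈ (W.conductorNorm ℤ).primeFactors, ((ℓ : ℕ) : 𝓞 L) ∈ w.asIdeal := by
    intro w hw
    obtain ⟨ℓ, hℓ, hℓw, hℓbad⟩ := exists_prime_mem_of_mem_D W₁ p hSmem (Finset.mem_union_right _ hw)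
    have hbadℓ : ¬ W.HasGoodReductionAtPrime ℓ := by
      rcases hℓbad with rfl | h
      · exact hbad
      · exact fun hg ↦ h ((hiso.hasGoodReductionAtPrime_iff ℓ).mp hg)
    exact ⟨ℓ, Nat.mem_primeFactors.mpr
      ⟨hℓ.out, (W.dvd_conductorNorm_iff_not_hasGoodReductionAtPrime ℓ).mpr hbadℓ, NeZero.ne _⟩, hℓw⟩
  -- the tied frame
  obtain ⟨𝔓', T, ϑ, CK, Ω, ΩpK, G, w₁, w₂, -, -, hrest⟩ :=
    exists_tiedFrame_of_frame_of_ne_two W hCM hp2 hin hbad hK hHN κ hγ h𝔭 h𝔭' hne hf hι hKatz h2 hx _ hc hψ1 hψ4 hψbad θ₀ a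
      hcθ hθ' hθram S hSP hS hlam hramS
  exact ⟨L, _, _, _, _, {𝔓'}, S, T, ψ.compRelNorm L * HeckeCharacter.normCharacter L, ϑ, CK, Ω, ΩpK, G, w₁, w₂, 1, 1,
    hrest⟩

end Summit.BirchSwinnertonDyer.BirchSwinnertonDyer.Theorems.InertBadSignedBranchesInertBadAtThreeHeartStubV2

end
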